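import Literature.NumberTheory.LFunctions.CardonRobertsOrthogonality
import Mathlib.Analysis.Polynomial.Basic
import Mathlib.Topology.Order.IntermediateValue
import HarnessLib

/-!
# RH-FREE · Zeros of the Cardon–Roberts orthogonal polynomials: real, simple, symmetric; the product forms `p_{2n}(z)/p_{2n}(0) = ∏ (1 − z²/x_{2n,k}²)` and `p_{2n+1}(z)/(z p'_{2n+1}(0)) = ∏ (1 − z²/x_{2n+1,k}²)` — nothing here bears on the truth of RH

Literature-typing tranche `rh-lit-broughan-2` (Broughan, *Equivalents of the Riemann Hypothesis*
Vol. 2, Ch. 6, §6.3 "Orthogonal polynomial properties"; Cardon–Roberts 2006, Lemma 2.1 and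
display (17)). Second layer of the proof of the tree's named fact `CardonRoberts2006_lemma_3_5`
(Broughan Thm 6.16), for a general measure `μ` on `ℝ` with all moments and not carried by the
zero set of a non-zero polynomial (hypotheses `hmom`, `hae` of `CardonRobertsOrthogonality`),
symmetric under `x ↦ −x` where stated (`hsym`):

* `CardonRobertsOP.eval_mul_prod_oddRoots_nonneg` — for any real `p ≠ 0` with positive leading
  coefficient, `p(x) · ∏_{r : odd multiplicity} (x − r) ≥ 0` on `ℝ` (the sign device of the
  classical proof that orthogonal polynomials have real simple zeros, Szegő Thm 3.3.1);
* `CardonRobertsOP.card_roots_toFinset`, `roots_nodup`, `eq_prod_roots` — **CR Lemma 2.1**: "The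
  zeros of `p_n(x)` are real and simple for each `n ≥ 1`": `p_n` has `n` distinct real roots and
  `p_n = ∏_{r} (X − r)` over them;
* `CardonRobertsOP.exists_even_prod`, `exists_odd_prod` — for symmetric `μ`:
  `p_{2n} = ∏_{k=1}^{n} (X² − x_{2n,k}²)` and `p_{2n+1} = X · ∏_{k=1}^{n} (X² − x_{2n+1,k}²)` with
  `0 < x_{·,1}, …, x_{·,n}` the positive zeros (CR p. 61: "Denote the `n` positive zeros of
  `p_{2n}(x)` as `x_{2n,1} < ⋯ < x_{2n,n}`. Similarly … `p_{2n+1}`");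
* `CardonRobertsOP.exists_evenRatio_eq_prod`, `exists_oddRatio_eq_prod` — **CR (17)**:
  `p_{2n}(z)/p_{2n}(0) = ∏_{k=1}^{n} (1 − z²/x_{2n,k}²)` and
  `p_{2n+1}(z)/(z p'_{2n+1}(0)) = ∏_{k=1}^{n} (1 − z²/x_{2n+1,k}²)` (`z ≠ 0`), for the tree's
  `cardonRobertsEvenRatio` / `cardonRobertsOddRatio`.

The positive zeros are packaged existentially as a `Finset ℝ` of cardinality `n` (no new
definitions). No named facts (D-0026); standard axioms only; nothing here bears on the truth of RH.

## References

* [CardonRoberts2006] D. A. Cardon, S. A. Roberts, J. Approx. Theory 138 (2006) 54–64: Lemma 2.1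
  p. 56 (= Szegő Thm 3.3.1 / Chihara Thm I.5.2), p. 60 (parity), p. 61 display (17).
* [Broughan2017] K. Broughan, *Equivalents of the Riemann Hypothesis* Vol. 2, CUP 2017, §6.3.
* G. Szegő, *Orthogonal Polynomials*, Thm 3.3.1.
-/

noncomputable section

open MeasureTheory Polynomial Filter

namespace Literature.NumberTheory.LFunctions

namespace CardonRobertsOP

variable {μ : Measure ℝ}

/-! ## §1 The sign device: `p · ∏_{odd-multiplicity roots} (X − r) ≥ 0` -/

/-- A real polynomial without real roots and with positive leading coefficient is positive on `ℝ`
(intermediate value theorem). [cite: CardonRoberts2006, Lemma 2.1 p. 56 (proof device, Szegő Thm 3.3.1)] -/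
theorem eval_pos_of_roots_eq_zero {q : ℝ[X]} (hq0 : q ≠ 0) (hroots : q.roots = 0)
    (hlc : 0 < q.leadingCoeff) (y : ℝ) : 0 < q.eval y := by
  have hne : ∀ t : ℝ, q.eval t ≠ 0 := by
    intro t ht
    have hmem : t ∈ q.roots := (mem_roots hq0).2 ht
    rw [hroots] at hmem
    exact Multiset.notMem_zero _ hmem
  -- a point where `q` is positive
  obtain ⟨y₀, hy₀⟩ : ∃ y₀ : ℝ, 0 < q.eval y₀ := by
    by_cases hdeg : 0 < q.degree
    · exact ((tendsto_atTop_of_leadingCoeff_nonneg q hdeg hlc.le).eventually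
        (eventually_gt_atTop 0)).exists
    · have hnat : q.natDegree = 0 := natDegree_eq_zero_iff_degree_le_zero.2 (not_lt.1 hdeg)
      refine ⟨0, ?_⟩
      rw [eq_C_of_degree_le_zero (not_lt.1 hdeg), eval_C]
      rw [leadingCoeff, hnat] at hlc
      exact hlc
  by_contra hy
  have hle : q.eval y ≤ 0 := not_lt.1 hy
  have hmem : (0 : ℝ) ∈ Set.Icc (q.eval y) (q.eval y₀) := ⟨hle, hy₀.le⟩
  obtain ⟨t, ht⟩ := intermediate_value_univ y y₀ q.continuous hmem
  exact hne t ht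

/-- **The sign device.** For a non-zero real polynomial `p` with positive leading coefficient, the
product of `p` with `∏ (X − r)` over its real roots `r` of ODD multiplicity is nonnegative on all
of `ℝ`: writing `p = q · ∏_r (X − r)^{m_r}` with `q` root-free (hence positive), every root then
occurs to an even power. [cite: CardonRoberts2006, Lemma 2.1 p. 56 (proof device, Szegő Thm 3.3.1)] -/
theorem eval_mul_prod_oddRoots_nonneg {p : ℝ[X]} (hp : p ≠ 0) (hlc : 0 < p.leadingCoeff) (x : ℝ) :
    0 ≤ (p * ∏ r ∈ p.roots.toFinset.filter (fun r ↦ Odd (p.rootMultiplicity r)), (X - C r)).eval x := by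
  classical
  obtain ⟨q, hpq, -, hq⟩ := p.exists_prod_multiset_X_sub_C_mul
  have hq0 : q ≠ 0 := by
    rintro rfl
    exact hp (by simpa using hpq.symm)
  have hmon : (p.roots.map fun a ↦ X - C a).prod.Monic :=
    monic_multiset_prod_of_monic _ _ fun a _ ↦ monic_X_sub_C a
  have hlcq : 0 < q.leadingCoeff := by
    have h1 : p.leadingCoeff = q.leadingCoeff := by
      rw [← hpq, leadingCoeff_mul, hmon.leadingCoeff, one_mul]
    rwa [← h1]
  have hqpos : 0 < q.eval x := eval_pos_of_roots_eq_zero hq0 hq hlcq x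
  -- evaluate the root part
  set T := p.roots.toFinset with hT
  have hprod : ((p.roots.map fun a ↦ X - C a).prod).eval x =
      ∏ r ∈ T, (x - r) ^ p.rootMultiplicity r := by
    rw [eval_multiset_prod, Multiset.map_map, Finset.prod_multiset_map_count]
    refine Finset.prod_congr rfl fun r _ ↦ ?_
    rw [count_roots]
    simp [Function.comp]
  have hodd : (∏ r ∈ T.filter (fun r ↦ Odd (p.rootMultiplicity r)), (X - C r)).eval x =
      ∏ r ∈ T, (if Odd (p.rootMultiplicity r) then (x - r) else 1) := by
    rw [eval_prod, Finset.prod_filter]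
    refine Finset.prod_congr rfl fun r _ ↦ ?_
    split_ifs <;> simp
  have hpe : p.eval x = (∏ r ∈ T, (x - r) ^ p.rootMultiplicity r) * q.eval x := by
    rw [← hprod, ← eval_mul, hpq]
  rw [eval_mul, hodd, hpe, mul_assoc, mul_comm (q.eval x), ← mul_assoc, ← Finset.prod_mul_distrib]
  refine mul_nonneg (Finset.prod_nonneg fun r _ ↦ ?_) hqpos.le
  split_ifs with h
  · rw [← pow_succ]
    exact Even.pow_nonneg (Odd.add_one h) _
  · rw [mul_one]
    exact Even.pow_nonneg (Nat.not_odd_iff_even.1 h) _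

/-! ## §2 CR Lemma 2.1: the zeros of `p_n` are real and simple -/

/-- **CR Lemma 2.1** (Szegő Thm 3.3.1, Chihara Thm I.5.2): "The zeros of `p_n(x)` are real and
simple for each `n ≥ 1`" — `p_n` has exactly `n` distinct real roots (and `n` roots with
multiplicity). Proof: if fewer than `n` real roots had odd multiplicity, `p_n` would be orthogonal
to `h = ∏_{odd} (X − r)`, while `p_n h ≥ 0` is non-zero, so `∫ p_n h dμ > 0`.
[cite: CardonRoberts2006, Lemma 2.1 p. 56] -/
theorem card_roots_toFinset (hmom : ∀ m : ℕ, Integrable (fun x : ℝ ↦ x ^ m) μ)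
    (hae : ∀ p : ℝ[X], (fun x : ℝ ↦ p.eval x) =ᵐ[μ] 0 → p = 0) (n : ℕ) :
    (cardonRobertsPoly μ n).roots.toFinset.card = n ∧
      Multiset.card (cardonRobertsPoly μ n).roots = n := by
  classical
  have hp0 : cardonRobertsPoly μ n ≠ 0 := ne_zero μ n
  have hDn : n ≤ ((cardonRobertsPoly μ n).roots.toFinset.filter
      (fun r ↦ Odd ((cardonRobertsPoly μ n).rootMultiplicity r))).card := by
    by_contra hlt
    push Not at hlt
    have hhmonic : (∏ r ∈ (cardonRobertsPoly μ n).roots.toFinset.filter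
        (fun r ↦ Odd ((cardonRobertsPoly μ n).rootMultiplicity r)), (X - C r)).Monic :=
      monic_prod_of_monic _ _ fun r _ ↦ monic_X_sub_C r
    have hhdeg : (∏ r ∈ (cardonRobertsPoly μ n).roots.toFinset.filter
        (fun r ↦ Odd ((cardonRobertsPoly μ n).rootMultiplicity r)), (X - C r)).degree <
        (n : WithBot ℕ) := by
      rw [degree_eq_natDegree hhmonic.ne_zero,
        natDegree_prod_of_monic _ _ (fun r _ ↦ monic_X_sub_C r)]
      simp only [natDegree_X_sub_C, Finset.sum_const, smul_eq_mul, mul_one]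
      exact_mod_cast hlt
    have h0 := inner_eq_zero_of_degree_lt hmom hae hhdeg
    have hpos : 0 < cardonRobertsInner μ (cardonRobertsPoly μ n)
        (∏ r ∈ (cardonRobertsPoly μ n).roots.toFinset.filter
          (fun r ↦ Odd ((cardonRobertsPoly μ n).rootMultiplicity r)), (X - C r)) := by
      rw [inner_eq_integral_mul]
      refine integral_pos_of_nonneg_ae hmom hae (mul_ne_zero hp0 hhmonic.ne_zero)
        (Eventually.of_forall fun x ↦ ?_)
      exact eval_mul_prod_oddRoots_nonneg hp0 (by rw [(monic μ n).leadingCoeff]; exact one_pos) x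
    exact hpos.ne' h0
  have h1 : ((cardonRobertsPoly μ n).roots.toFinset.filter
      (fun r ↦ Odd ((cardonRobertsPoly μ n).rootMultiplicity r))).card ≤
      (cardonRobertsPoly μ n).roots.toFinset.card := Finset.card_filter_le _ _
  have h2 : (cardonRobertsPoly μ n).roots.toFinset.card ≤
      Multiset.card (cardonRobertsPoly μ n).roots := Multiset.toFinset_card_le _
  have h3 : Multiset.card (cardonRobertsPoly μ n).roots ≤ n :=
    (card_roots' _).trans (natDegree_eq μ n).le
  constructor <;> omega

/-- The roots of `p_n` are simple (the multiset of roots has no duplicates).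
[cite: CardonRoberts2006, Lemma 2.1 p. 56] -/
theorem roots_nodup (hmom : ∀ m : ℕ, Integrable (fun x : ℝ ↦ x ^ m) μ)
    (hae : ∀ p : ℝ[X], (fun x : ℝ ↦ p.eval x) =ᵐ[μ] 0 → p = 0) (n : ℕ) :
    (cardonRobertsPoly μ n).roots.Nodup := by
  have h := card_roots_toFinset hmom hae n
  exact Multiset.toFinset_card_eq_card_iff_nodup.1 (by rw [h.1, h.2])

/-- `p_n` splits over `ℝ` with simple roots: `p_n = ∏_{r ∈ roots} (X − r)`.
[cite: CardonRoberts2006, Lemma 2.1 p. 56] -/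
theorem eq_prod_roots (hmom : ∀ m : ℕ, Integrable (fun x : ℝ ↦ x ^ m) μ)
    (hae : ∀ p : ℝ[X], (fun x : ℝ ↦ p.eval x) =ᵐ[μ] 0 → p = 0) (n : ℕ) :
    cardonRobertsPoly μ n = ∏ r ∈ (cardonRobertsPoly μ n).roots.toFinset, (X - C r) := by
  classical
  have hnd := roots_nodup hmom hae n
  rw [Finset.prod_eq_multiset_prod, Multiset.toFinset_val, hnd.dedup]
  exact (prod_multiset_X_sub_C_of_monic_of_roots_card_eq (monic μ n)
    (by rw [(card_roots_toFinset hmom hae n).2, natDegree_eq])).symm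

/-- Membership in the root set: `r ∈ roots ⇔ p_n(r) = 0`. [cite: CardonRoberts2006, Lemma 2.1 p. 56] -/
theorem mem_roots_toFinset_iff (n : ℕ) (r : ℝ) :
    r ∈ (cardonRobertsPoly μ n).roots.toFinset ↔ (cardonRobertsPoly μ n).eval r = 0 := by
  classical
  rw [Multiset.mem_toFinset, mem_roots (ne_zero μ n), IsRoot.def]

/-! ## §3 Symmetric measures: the positive zeros and the product forms -/

/-- For symmetric `μ` the root set of `p_n` is symmetric under `r ↦ −r`.
[cite: CardonRoberts2006, §3 p. 60–61] -/
theorem neg_mem_roots_toFinset (hmom : ∀ m : ℕ, Integrable (fun x : ℝ ↦ x ^ m) μ)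
    (hae : ∀ p : ℝ[X], (fun x : ℝ ↦ p.eval x) =ᵐ[μ] 0 → p = 0)
    (hsym : ∀ p : ℝ[X], ∫ x, p.eval (-x) ∂μ = ∫ x, p.eval x ∂μ) (n : ℕ) {r : ℝ}
    (hr : r ∈ (cardonRobertsPoly μ n).roots.toFinset) :
    -r ∈ (cardonRobertsPoly μ n).roots.toFinset := by
  rw [mem_roots_toFinset_iff] at hr ⊢
  rw [eval_neg hmom hae hsym, hr, mul_zero]

/-- Counting a finite symmetric set of reals: `#T = 2·#{r ∈ T : r > 0} + #{r ∈ T : r = 0}`.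
[cite: CardonRoberts2006, §3 p. 61 ("the `n` positive zeros of `p_{2n}`")] -/
theorem card_eq_two_mul_card_pos_add (T : Finset ℝ) (hT : ∀ r ∈ T, -r ∈ T) :
    T.card = 2 * (T.filter (fun r ↦ 0 < r)).card + (T.filter (fun r ↦ r = 0)).card := by
  classical
  have h1 := Finset.card_filter_add_card_filter_not (s := T) (fun r : ℝ ↦ 0 < r)
  have h2 := Finset.card_filter_add_card_filter_not
    (s := T.filter (fun r : ℝ ↦ ¬ 0 < r)) (fun r : ℝ ↦ r < 0)
  have hneg : (T.filter (fun r : ℝ ↦ ¬ 0 < r)).filter (fun r : ℝ ↦ r < 0) =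
      (T.filter (fun r ↦ 0 < r)).image (fun r ↦ -r) := by
    ext r
    simp only [Finset.mem_filter, Finset.mem_image]
    constructor
    · rintro ⟨⟨hr, -⟩, hr0⟩
      exact ⟨-r, ⟨hT r hr, by linarith⟩, neg_neg r⟩
    · rintro ⟨s, ⟨hs, hs0⟩, rfl⟩
      exact ⟨⟨hT s hs, by linarith⟩, by linarith⟩
  have hzero : (T.filter (fun r : ℝ ↦ ¬ 0 < r)).filter (fun r : ℝ ↦ ¬ r < 0) =
      T.filter (fun r ↦ r = 0) := by
    ext r
    simp only [Finset.mem_filter, not_lt]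
    constructor
    · rintro ⟨⟨hr, h1⟩, h2⟩; exact ⟨hr, le_antisymm h1 h2⟩
    · rintro ⟨hr, rfl⟩; exact ⟨⟨hr, le_rfl⟩, le_rfl⟩
  rw [hneg, hzero, Finset.card_image_of_injective _ neg_injective] at h2
  omega

/-- **The `n` positive zeros of `p_{2n}`** (symmetric `μ`): there is a set `Z` of `n` positive
reals — the positive zeros `x_{2n,1}, …, x_{2n,n}` — with `p_{2n} = ∏_{x ∈ Z} (X² − x²)`; in
particular `0` is not a zero. [cite: CardonRoberts2006, §3 p. 61 and (17)] -/
theorem exists_even_prod (hmom : ∀ m : ℕ, Integrable (fun x : ℝ ↦ x ^ m) μ)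
    (hae : ∀ p : ℝ[X], (fun x : ℝ ↦ p.eval x) =ᵐ[μ] 0 → p = 0)
    (hsym : ∀ p : ℝ[X], ∫ x, p.eval (-x) ∂μ = ∫ x, p.eval x ∂μ) (n : ℕ) :
    ∃ Z : Finset ℝ, Z.card = n ∧ (∀ x ∈ Z, 0 < x) ∧
      (∀ x : ℝ, x ∈ Z ↔ 0 < x ∧ (cardonRobertsPoly μ (2 * n)).eval x = 0) ∧
      cardonRobertsPoly μ (2 * n) = ∏ x ∈ Z, (X ^ 2 - C (x ^ 2)) := by
  classical
  set T := (cardonRobertsPoly μ (2 * n)).roots.toFinset with hT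
  have hTcard : T.card = 2 * n := (card_roots_toFinset hmom hae (2 * n)).1
  have hTneg : ∀ r ∈ T, -r ∈ T := fun r hr ↦ neg_mem_roots_toFinset hmom hae hsym (2 * n) hr
  have hcount := card_eq_two_mul_card_pos_add T hTneg
  have hle1 : (T.filter (fun r ↦ r = 0)).card ≤ 1 := by
    rw [Finset.filter_eq' T 0]
    split_ifs <;> simp
  have hT0 : (T.filter (fun r ↦ r = 0)).card = 0 := by omega
  have h0notin : (0 : ℝ) ∉ T := by
    intro h0
    have : (0 : ℝ) ∈ T.filter (fun r ↦ r = 0) := Finset.mem_filter.2 ⟨h0, rfl⟩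
    rw [Finset.card_eq_zero] at hT0
    simp [hT0] at this
  refine ⟨T.filter (fun r ↦ 0 < r), by omega, fun x hx ↦ (Finset.mem_filter.1 hx).2, ?_, ?_⟩
  · intro x
    rw [Finset.mem_filter, hT, mem_roots_toFinset_iff, and_comm]
  have hnegset : T.filter (fun r : ℝ ↦ ¬ 0 < r) = (T.filter (fun r ↦ 0 < r)).image (fun r ↦ -r) := by
    ext r
    simp only [Finset.mem_filter, Finset.mem_image]
    constructor
    · rintro ⟨hr, hr0⟩
      have hr0' : r ≠ 0 := fun h ↦ h0notin (h ▸ hr)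
      exact ⟨-r, ⟨hTneg r hr, by rcases lt_or_gt_of_ne hr0' with h | h <;> [linarith; exact absurd h hr0]⟩,
        neg_neg r⟩
    · rintro ⟨s, ⟨hs, hs0⟩, rfl⟩
      exact ⟨hTneg s hs, by linarith⟩
  calc cardonRobertsPoly μ (2 * n)
      = ∏ r ∈ T, (X - C r) := eq_prod_roots hmom hae (2 * n)
    _ = (∏ r ∈ T.filter (fun r ↦ 0 < r), (X - C r)) *
          ∏ r ∈ T.filter (fun r : ℝ ↦ ¬ 0 < r), (X - C r) :=
        (Finset.prod_filter_mul_prod_filter_not T (fun r : ℝ ↦ 0 < r) _).symm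
    _ = (∏ r ∈ T.filter (fun r ↦ 0 < r), (X - C r)) *
          ∏ r ∈ T.filter (fun r ↦ 0 < r), (X - C (-r)) := by
        rw [hnegset, Finset.prod_image fun a _ b _ h ↦ neg_injective h]
    _ = ∏ x ∈ T.filter (fun r ↦ 0 < r), (X ^ 2 - C (x ^ 2)) := by
        rw [← Finset.prod_mul_distrib]
        refine Finset.prod_congr rfl fun x _ ↦ ?_
        simp only [map_neg, map_pow, sub_neg_eq_add]
        ring

/-- **The `n` positive zeros of `p_{2n+1}`** (symmetric `μ`): `p_{2n+1} = X · ∏_{x ∈ Z} (X² − x²)`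
with `Z` a set of `n` positive reals. [cite: CardonRoberts2006, §3 p. 61 and (17)] -/
theorem exists_odd_prod (hmom : ∀ m : ℕ, Integrable (fun x : ℝ ↦ x ^ m) μ)
    (hae : ∀ p : ℝ[X], (fun x : ℝ ↦ p.eval x) =ᵐ[μ] 0 → p = 0)
    (hsym : ∀ p : ℝ[X], ∫ x, p.eval (-x) ∂μ = ∫ x, p.eval x ∂μ) (n : ℕ) :
    ∃ Z : Finset ℝ, Z.card = n ∧ (∀ x ∈ Z, 0 < x) ∧
      (∀ x : ℝ, x ∈ Z ↔ 0 < x ∧ (cardonRobertsPoly μ (2 * n + 1)).eval x = 0) ∧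
      cardonRobertsPoly μ (2 * n + 1) = X * ∏ x ∈ Z, (X ^ 2 - C (x ^ 2)) := by
  classical
  set T := (cardonRobertsPoly μ (2 * n + 1)).roots.toFinset with hT
  have hTcard : T.card = 2 * n + 1 := (card_roots_toFinset hmom hae (2 * n + 1)).1
  have hTneg : ∀ r ∈ T, -r ∈ T := fun r hr ↦ neg_mem_roots_toFinset hmom hae hsym (2 * n + 1) hr
  have hcount := card_eq_two_mul_card_pos_add T hTneg
  have h0in : (0 : ℝ) ∈ T := by
    rw [hT, mem_roots_toFinset_iff]
    exact eval_zero_odd hmom hae hsym n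
  have hzeroset : T.filter (fun r ↦ r = 0) = {0} := by
    rw [Finset.filter_eq' T 0, if_pos h0in]
  have hT0 : (T.filter (fun r ↦ r = 0)).card = 1 := by rw [hzeroset, Finset.card_singleton]
  refine ⟨T.filter (fun r ↦ 0 < r), by omega, fun x hx ↦ (Finset.mem_filter.1 hx).2, ?_, ?_⟩
  · intro x
    rw [Finset.mem_filter, hT, mem_roots_toFinset_iff, and_comm]
  have hnegset : (T.filter (fun r : ℝ ↦ ¬ 0 < r)).filter (fun r : ℝ ↦ r < 0) =
      (T.filter (fun r ↦ 0 < r)).image (fun r ↦ -r) := by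
    ext r
    simp only [Finset.mem_filter, Finset.mem_image]
    constructor
    · rintro ⟨⟨hr, -⟩, hr0⟩
      exact ⟨-r, ⟨hTneg r hr, by linarith⟩, neg_neg r⟩
    · rintro ⟨s, ⟨hs, hs0⟩, rfl⟩
      exact ⟨⟨hTneg s hs, by linarith⟩, by linarith⟩
  have hzeroset' : (T.filter (fun r : ℝ ↦ ¬ 0 < r)).filter (fun r : ℝ ↦ ¬ r < 0) = {0} := by
    rw [← hzeroset]
    ext r
    simp only [Finset.mem_filter, not_lt]
    constructor
    · rintro ⟨⟨hr, h1⟩, h2⟩; exact ⟨hr, le_antisymm h1 h2⟩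
    · rintro ⟨hr, rfl⟩; exact ⟨⟨hr, le_rfl⟩, le_rfl⟩
  calc cardonRobertsPoly μ (2 * n + 1)
      = ∏ r ∈ T, (X - C r) := eq_prod_roots hmom hae (2 * n + 1)
    _ = (∏ r ∈ T.filter (fun r ↦ 0 < r), (X - C r)) *
          ∏ r ∈ T.filter (fun r : ℝ ↦ ¬ 0 < r), (X - C r) :=
        (Finset.prod_filter_mul_prod_filter_not T (fun r : ℝ ↦ 0 < r) _).symm
    _ = (∏ r ∈ T.filter (fun r ↦ 0 < r), (X - C r)) *
          ((∏ r ∈ (T.filter (fun r : ℝ ↦ ¬ 0 < r)).filter (fun r : ℝ ↦ r < 0), (X - C r)) *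
            ∏ r ∈ (T.filter (fun r : ℝ ↦ ¬ 0 < r)).filter (fun r : ℝ ↦ ¬ r < 0), (X - C r)) := by
        rw [Finset.prod_filter_mul_prod_filter_not (T.filter (fun r : ℝ ↦ ¬ 0 < r))
          (fun r : ℝ ↦ r < 0)]
    _ = (∏ r ∈ T.filter (fun r ↦ 0 < r), (X - C r)) *
          ((∏ r ∈ T.filter (fun r ↦ 0 < r), (X - C (-r))) * X) := by
        rw [hnegset, Finset.prod_image fun a _ b _ h ↦ neg_injective h, hzeroset',
          Finset.prod_singleton, map_zero, sub_zero]
    _ = X * ∏ x ∈ T.filter (fun r ↦ 0 < r), (X ^ 2 - C (x ^ 2)) := by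
        rw [← mul_assoc, ← Finset.prod_mul_distrib, mul_comm]
        congr 1
        refine Finset.prod_congr rfl fun x _ ↦ ?_
        simp only [map_neg, map_pow, sub_neg_eq_add]
        ring

/-- Complex evaluation of the even product: `p(z) = ∏ (z² − x²)` for `p = ∏ (X² − x²)`.
[cite: CardonRoberts2006, (17) p. 61] -/
theorem aeval_prod_X_sq_sub (Z : Finset ℝ) (z : ℂ) :
    aeval z (∏ x ∈ Z, (X ^ 2 - C (x ^ 2) : ℝ[X])) = ∏ x ∈ Z, (z ^ 2 - ((x : ℂ)) ^ 2) := by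
  rw [map_prod]
  refine Finset.prod_congr rfl fun x _ ↦ ?_
  simp [aeval_C]

/-- Real evaluation at `0` of the even product: `p(0) = ∏ (−x²)`. [cite: CardonRoberts2006, (17) p. 61] -/
theorem eval_zero_prod_X_sq_sub (Z : Finset ℝ) :
    (∏ x ∈ Z, (X ^ 2 - C (x ^ 2) : ℝ[X])).eval 0 = ∏ x ∈ Z, (-(x ^ 2)) := by
  rw [eval_prod]
  refine Finset.prod_congr rfl fun x _ ↦ ?_
  simp

/-- **CR (17), even case**: for symmetric `μ`, `p_{2n}(0) ≠ 0` and
`p_{2n}(z)/p_{2n}(0) = ∏_{k=1}^{n} (1 − z²/x_{2n,k}²)` over the `n` positive zeros.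
[cite: CardonRoberts2006, (17) p. 61] -/
theorem exists_evenRatio_eq_prod (hmom : ∀ m : ℕ, Integrable (fun x : ℝ ↦ x ^ m) μ)
    (hae : ∀ p : ℝ[X], (fun x : ℝ ↦ p.eval x) =ᵐ[μ] 0 → p = 0)
    (hsym : ∀ p : ℝ[X], ∫ x, p.eval (-x) ∂μ = ∫ x, p.eval x ∂μ) (n : ℕ) :
    ∃ Z : Finset ℝ, Z.card = n ∧ (∀ x ∈ Z, 0 < x) ∧
      (∀ x : ℝ, x ∈ Z ↔ 0 < x ∧ (cardonRobertsPoly μ (2 * n)).eval x = 0) ∧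
      cardonRobertsPoly μ (2 * n) = ∏ x ∈ Z, (X ^ 2 - C (x ^ 2)) ∧
      (cardonRobertsPoly μ (2 * n)).eval 0 ≠ 0 ∧
      ∀ z : ℂ, cardonRobertsEvenRatio μ n z = ∏ x ∈ Z, (1 - z ^ 2 / ((x : ℂ)) ^ 2) := by
  obtain ⟨Z, hcard, hpos, hmem, hprod⟩ := exists_even_prod hmom hae hsym n
  have h0 : (cardonRobertsPoly μ (2 * n)).eval 0 = ∏ x ∈ Z, (-(x ^ 2)) := by
    rw [hprod, eval_zero_prod_X_sq_sub]
  have h0ne : (cardonRobertsPoly μ (2 * n)).eval 0 ≠ 0 := by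
    rw [h0]
    exact Finset.prod_ne_zero_iff.2 fun x hx ↦ neg_ne_zero.2 (pow_ne_zero _ (hpos x hx).ne')
  refine ⟨Z, hcard, hpos, hmem, hprod, h0ne, fun z ↦ ?_⟩
  rw [cardonRobertsEvenRatio, hprod, aeval_prod_X_sq_sub, eval_zero_prod_X_sq_sub,
    Complex.ofReal_prod, ← Finset.prod_div_distrib]
  refine Finset.prod_congr rfl fun x hx ↦ ?_
  have hx : ((x : ℂ)) ≠ 0 := Complex.ofReal_ne_zero.2 (hpos x hx).ne'
  push_cast
  field_simp
  ring

/-- **CR (17), odd case**: for symmetric `μ` and `z ≠ 0`, `p'_{2n+1}(0) ≠ 0` and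
`p_{2n+1}(z)/(z p'_{2n+1}(0)) = ∏_{k=1}^{n} (1 − z²/x_{2n+1,k}²)` over the `n` positive zeros.
[cite: CardonRoberts2006, (17) p. 61] -/
theorem exists_oddRatio_eq_prod (hmom : ∀ m : ℕ, Integrable (fun x : ℝ ↦ x ^ m) μ)
    (hae : ∀ p : ℝ[X], (fun x : ℝ ↦ p.eval x) =ᵐ[μ] 0 → p = 0)
    (hsym : ∀ p : ℝ[X], ∫ x, p.eval (-x) ∂μ = ∫ x, p.eval x ∂μ) (n : ℕ) :
    ∃ Z : Finset ℝ, Z.card = n ∧ (∀ x ∈ Z, 0 < x) ∧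
      (∀ x : ℝ, x ∈ Z ↔ 0 < x ∧ (cardonRobertsPoly μ (2 * n + 1)).eval x = 0) ∧
      cardonRobertsPoly μ (2 * n + 1) = X * ∏ x ∈ Z, (X ^ 2 - C (x ^ 2)) ∧
      (derivative (cardonRobertsPoly μ (2 * n + 1))).eval 0 = ∏ x ∈ Z, (-(x ^ 2)) ∧
      (derivative (cardonRobertsPoly μ (2 * n + 1))).eval 0 ≠ 0 ∧
      ∀ z : ℂ, z ≠ 0 → cardonRobertsOddRatio μ n z = ∏ x ∈ Z, (1 - z ^ 2 / ((x : ℂ)) ^ 2) := by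
  obtain ⟨Z, hcard, hpos, hmem, hprod⟩ := exists_odd_prod hmom hae hsym n
  have hder : (derivative (cardonRobertsPoly μ (2 * n + 1))).eval 0 = ∏ x ∈ Z, (-(x ^ 2)) := by
    rw [hprod, derivative_mul, derivative_X, one_mul, eval_add, eval_mul, eval_X, zero_mul,
      add_zero, eval_zero_prod_X_sq_sub]
  have hne : ∏ x ∈ Z, (-(x ^ 2)) ≠ 0 :=
    Finset.prod_ne_zero_iff.2 fun x hx ↦ neg_ne_zero.2 (pow_ne_zero _ (hpos x hx).ne')
  refine ⟨Z, hcard, hpos, hmem, hprod, hder, by rwa [hder], fun z hz ↦ ?_⟩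
  rw [cardonRobertsOddRatio, hder, hprod, map_mul, aeval_X, aeval_prod_X_sq_sub,
    Complex.ofReal_prod, mul_div_mul_left _ _ hz, ← Finset.prod_div_distrib]
  refine Finset.prod_congr rfl fun x hx ↦ ?_
  have hx : ((x : ℂ)) ≠ 0 := Complex.ofReal_ne_zero.2 (hpos x hx).ne'
  push_cast
  field_simp
  ring

end CardonRobertsOP

end Literature.NumberTheory.LFunctions

end
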